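import Summits.BirchSwinnertonDyer.BirchSwinnertonDyer.Theorems.ErratumRoadFiveIMCDivAtDiscrDefs
import HarnessLib

/-!
# Route `ErratumRoadFive` (rung K2, `p ≥ 5`), crux `IMCDivAtErratumDataAll` (item stmt-BirchSwinnertonDyer-19270, H3♭):
# the RE-ORIENTED atoms — X-slot at the OTHER prime above `p` (ORIENT-AUDIT-19270, repair form (a)) — DEFINITIONS + bridges

Cell `bsd-stepL` (run/shared/lean/pub/bsd-stepL/), seat `bsd-stepL-imc24b` (prover g4, 2026-08-27); `--supports
stmt-BirchSwinnertonDyer-19270 --as helper`; Theses-free (imports only imc-p1's Theses-free `ErratumRoadFiveIMCDivAtDiscrDefs`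
and, through it, the X11b library), so skeletons, rung files and a route `closes` term can import it. This is deliverable
(G1) of planner g30's RULING 1 (STATUS 2026-08-27T02:49:25Z), written to the REPAIR TEXT Q4 (a) of
`HOME/audit/ORIENT-AUDIT-19270-imc-p1-g8.md` (verdict of record: MISSTATED-ORIENTATION CONFIRMED).

WHY. As registered, crux 19270's atom `P2.IMCDivIntCoreFrameAtErratumData W p` (`X11b/BDPRouteErratumData.lean`) pairs a
♭-frame `Q` with Castella's interpolation property at the embedding datum `(ι′, 𝔭_{ι′})`
(`R1.IsBDPLFunctionInt p ι' (primeOfEmbeddingDatum p ι' w₀.embedding) …`) with the anticyclotomic Selmer dual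
`XAc (W.baseChange K) p κ 𝔭_{ι′} ∅ γ` STRICT AT THE SAME prime. The tree's `Λ`-action on `XAc` is PRECOMPOSITION
(`XAc.X_smul_apply`), the frame specialises at avatars of Hodge–Tate weight `−n` at `𝔭_{ι′}`, and the Bloch–Kato-consistent
partner of such a frame is the dual strict at the OTHER prime `𝔭̄_{ι′}` (audit Q1 S1–S6, §2; cell `bsd-eis` c3h MEMO-2): as
typed, the atom states the faithful one-sided divisibility AND an unprinted `ι`-invariance of `Ch_Λ(X_ac)·𝓞_{ℂ_p}⟦T⟧`.
Repair form (a), adopted by the planner: ONE token — the X-slot `primeOfEmbeddingDatum p ι' w₀.embedding` becomes a binder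
`𝔭bar ∋ p`, `𝔭bar ≠ 𝔭_{ι′}`; the frame, the value conjunct and every print-facing binder are UNCHANGED. (The planner's
superscript `ᴮ` is spelled `B` in identifiers.)

## What this file declares (three `@[conjecture]` shapes with bodies; nothing asserted) and proves

* §1 **`P2.IMCDivIntFrameAtErratumDataB W p`**, **`P2.IMCDivIntCoreFrameAtErratumDataB W p`** — the bodies of
  `P2.IMCDivIntFrameAtErratumData` ∕ `P2.IMCDivIntCoreFrameAtErratumData` VERBATIM, with, after the compatibility clause
  `he`, the binders `(𝔭bar : HeightOneSpectrum (𝓞 K))`, `((p : ℕ) : 𝓞 K) ∈ 𝔭bar.asIdeal`,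
  `𝔭bar ≠ primeOfEmbeddingDatum p ι' w₀.embedding`, and the divisibility conjunct on `XAc (W.baseChange K) p κ 𝔭bar ∅ γ`;
  **`P2.IMCDivIntCoreFrameAtDiscrB W p d`** — the core shape restricted to the erratum fields of ONE discriminant `d`
  (imc-p1's `P2.IMCDivIntCoreFrameAtDiscr` re-oriented; the statement of per-discriminant rungs). The ∀-wrapper
  `∀ W p, P2.IMCDivIntCoreFrameAtErratumDataB W p` is NOT named here (the repaired route item names it).
* §2 bridges, X-slot-free hence verbatim from the A-versions: forget the value; on a SEMISTABLE pair the value conjunct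
  comes from print (`h32` = Cas18 Thms. 3.1–3.2, ♭-V1RIG across periods, as `P2.imcDivIntFrameAtErratumData_of_thm32_of_core`);
  core ⟺ all per-discriminant slices.
* §3 unit data: at a unit datum the printed frame is a UNIT of `𝓞_{ℂ_p}⟦T⟧` (imc-p1's `P2.exists_unitFrame_of_thm32_of_unitValue`,
  `IsUnit Q`), so the divisibility holds for EVERY X-slot — the landed unit rungs (imc-p1's 5235a1, imc24b's split 5385b1)
  are `ι`-blind and re-read for the B-atoms by `P2.imcDivIntCoreFrameAtDiscrB_of_thm32_of_unitCertAtDiscr`.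

HONEST FRAMING: definitions with bodies (open shapes, `[claim: Castella2018Erratum, status: under-review]`) and bookkeeping
theorems; no named fact, no instance, no notation, no `sorry`; nothing is booked; BSD is proved for no pair; the anticyclotomic
main conjecture is asserted nowhere; which orientation print uses is the audit's reading (Q1–Q2), not a kernel statement —
the kernel fact that would make «registered ⟺ faithful ∧ ι-invariance» a theorem (the `c`-transport
`XAc … 𝔭̄ … ≃ₛₗ[ι] XAc … 𝔭 …`) is NOT attempted here.

References: [Castella2018] Thm. 3.1, display (3.2), Thm. 3.2, Def. 2.2 (arXiv:1704.06608 pp. 5, 9); [Castella2018Erratum]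
(2.4) (p. 4); [CastellaGrossiLeeSkinner2022] Thm. 5.1.1 (frame at `(ι_p, v)`, module strict at `v̄` — the printed
"family B" layout); [JetchevSkinnerWan2017] §2.3.2–2.3.3; cell files `HOME/audit/ORIENT-AUDIT-19270-imc-p1-g8.md`,
`pub/bsd-eis/c3h-MEMO-2.md`.
-/

noncomputable section

open scoped Classical

open WeierstrassCurve NumberField IsDedekindDomain Field PowerSeries
open Literature.NumberTheory.EllipticCurves Literature.NumberTheory.EllipticCurves.GreenbergSelmer
open Literature.NumberTheory.EllipticCurves.ModularForms
open Literature.NumberTheory.EllipticCurves.Rank1Residual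
open Literature.NumberTheory.EllipticCurves.Rank1Residual.Typed
open Literature.NumberTheory.EllipticCurves.Castella2018
open Literature.NumberTheory.GaloisRepresentations
open Literature.NumberTheory.GaloisCohomology
open Summit.BirchSwinnertonDyer.Rank1Residual.X11b.AcSelmer
open Summit.BirchSwinnertonDyer.Rank1Residual.X11b.Halves

namespace Summit.BirchSwinnertonDyer.Rank1Residual.X11b

/-! ### §1 The re-oriented shapes -/

section Shape

variable (W : WeierstrassCurve ℚ) [W.IsElliptic] [W.IsGloballyMinimal] (p : ℕ) [Fact p.Prime]

/-- **(2.4)♭ ONE-SIDED, WITH VALUE, AT ROUTE R1's ERRATUM DATA — RE-ORIENTED (X-slot at the OTHER prime).** The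
binders of `P2.IMCDivIntFrameAtErratumData W p` VERBATIM; then for every prime `𝔭bar ∋ p` of `K` OTHER than the datum's
prime `𝔭_{ι′} = primeOfEmbeddingDatum p ι' w₀.embedding` THERE IS a ♭-frame `(Ω_K ≠ 0, ‖Ω_p‖ = 1, Q ∈ 𝓞_{ℂ_p}⟦T⟧)` with
Castella's interpolation property AT `(ι′, 𝔭_{ι′})` [Cas18 Thm. 3.1, receptacle widened], the value
`Q(𝟙) = u·((1 − a_p(E) p⁻¹)·log_{ω_E} P)²`, `‖u‖ = 1`, read through the datum's embedding `e ↔ 𝔭_{ι′}` [Cas18 Thm. 3.2], and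
the DIVISIBILITY `Ch_Λ(X_ac(E[p^∞]; strict at 𝔭bar))·𝓞_{ℂ_p}⟦T⟧ ⊆ (Q)` [erratum (2.4) ⇐ [FW21, Thm. 4.41] + Hida descent —
PREPRINT], the Bloch–Kato-consistent partner of a frame at `(ι′, 𝔭_{ι′})` for the tree's precomposition `Λ`-action
(ORIENT-AUDIT-19270 Q1–Q4). A predicate on `(W, p)`; NEVER a theorem in this cell; every result using it is CONDITIONAL.
[claim: Castella2018Erratum, status: under-review]
[cite: Castella2018, Thm. 3.1, display (3.2) and Thm. 3.2 (arXiv:1704.06608 p. 9) (shape only; nothing asserted)]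
[cite: CastellaGrossiLeeSkinner2022, Thm. 5.1.1 (frame at `(ι_p, v)`, module strict at `v̄`; shape only)] -/
@[conjecture]
def P2.IMCDivIntFrameAtErratumDataB : Prop :=
  ∀ [NeZero (W.conductorNorm ℤ)] (q : ℕ) [Fact q.Prime] (K : Type) [Field K] [NumberField K]
    (Dt : ModularParametrizationData W (W.conductorNorm ℤ))
    (H : HeegnerDatum (W.conductorNorm ℤ) (NumberField.discr K)) (w₀ : InfinitePlace K)
    (P : (W.baseChange K).toAffine.Point), ErratumHypotheses W p → W.analyticRank = 1 →
    q ≠ p → Mult W q → ¬ W.HasSplitMultiplicativeReductionAtPrime q →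
    ¬ p ∣ padicValInt q W.minimalDiscriminantInt → IsErratumField W K q →
    Cas20Standing K p (W.conductorNorm ℤ / p) →
    WeierstrassCurve.Affine.Point.map w₀.embedding.toRatAlgHom P = heegnerPointComplex Dt H →
    ¬ (p : ℤ) ∣ Dt.c → ¬ IsOfFinAddOrder P →
    ∀ (κ : ZpExtension K p), κ.IsAnticyclotomic →
      ∀ (γ : Field.absoluteGaloisGroup K) [Fact (κ.IsTopGenerator γ)] (ι' : PadicAlgCl p ≃+* ℂ)
        (e : K →+* ℚ_[p]),
        (∀ k : 𝓞 K, k ∈ (primeOfEmbeddingDatum p ι' w₀.embedding).asIdeal ↔ ‖e (k : K)‖ < 1) →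
        ∀ (𝔭bar : HeightOneSpectrum (𝓞 K)), ((p : ℕ) : 𝓞 K) ∈ 𝔭bar.asIdeal →
          𝔭bar ≠ primeOfEmbeddingDatum p ι' w₀.embedding →
          ∃ (ΩK : ℂ) (Ωp : ℂ_[p]) (Q : PowerSeries 𝓞_ℂ_[p]), ΩK ≠ 0 ∧ ‖Ωp‖ = 1 ∧
            R1.IsBDPLFunctionInt p ι' (primeOfEmbeddingDatum p ι' w₀.embedding) κ γ Dt.f ΩK Ωp Q ∧
            R1.BDPValueAtOneIntAt W p e P Q (W.LFunction p) ∧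
            (XAc.charIdeal (W.baseChange K) p κ 𝔭bar ∅ γ).map (PowerSeries.map (R1.toCpInt p)) ≤
              Ideal.span {Q}

/-- **(2.4)♭ ONE-SIDED CORE (no value conjunct), AT ROUTE R1's ERRATUM DATA — RE-ORIENTED (X-slot at the OTHER prime).**
The binders of `P2.IMCDivIntCoreFrameAtErratumData W p` VERBATIM, then `𝔭bar ∋ p`, `𝔭bar ≠ 𝔭_{ι′}`, and a ♭-frame at
`(ι′, 𝔭_{ι′})` with the divisibility for `XAc (W.baseChange K) p κ 𝔭bar ∅ γ`. The currency of the repaired crux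
(`∀ W p, P2.IMCDivIntCoreFrameAtErratumDataB W p`, named by the route item, not here); on SEMISTABLE pairs the value
conjunct is supplied from print (§2). A predicate on `(W, p)`; NEVER a theorem in this cell.
[claim: Castella2018Erratum, status: under-review]
[cite: Castella2018, Thm. 3.1 and display (3.2) (arXiv:1704.06608 p. 9) (shape only; nothing asserted)] -/
@[conjecture]
def P2.IMCDivIntCoreFrameAtErratumDataB : Prop :=
  ∀ [NeZero (W.conductorNorm ℤ)] (q : ℕ) [Fact q.Prime] (K : Type) [Field K] [NumberField K]
    (Dt : ModularParametrizationData W (W.conductorNorm ℤ))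
    (H : HeegnerDatum (W.conductorNorm ℤ) (NumberField.discr K)) (w₀ : InfinitePlace K)
    (P : (W.baseChange K).toAffine.Point), ErratumHypotheses W p → W.analyticRank = 1 →
    q ≠ p → Mult W q → ¬ W.HasSplitMultiplicativeReductionAtPrime q →
    ¬ p ∣ padicValInt q W.minimalDiscriminantInt → IsErratumField W K q →
    Cas20Standing K p (W.conductorNorm ℤ / p) →
    WeierstrassCurve.Affine.Point.map w₀.embedding.toRatAlgHom P = heegnerPointComplex Dt H →
    ¬ (p : ℤ) ∣ Dt.c → ¬ IsOfFinAddOrder P →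
    ∀ (κ : ZpExtension K p), κ.IsAnticyclotomic →
      ∀ (γ : Field.absoluteGaloisGroup K) [Fact (κ.IsTopGenerator γ)] (ι' : PadicAlgCl p ≃+* ℂ)
        (e : K →+* ℚ_[p]),
        (∀ k : 𝓞 K, k ∈ (primeOfEmbeddingDatum p ι' w₀.embedding).asIdeal ↔ ‖e (k : K)‖ < 1) →
        ∀ (𝔭bar : HeightOneSpectrum (𝓞 K)), ((p : ℕ) : 𝓞 K) ∈ 𝔭bar.asIdeal →
          𝔭bar ≠ primeOfEmbeddingDatum p ι' w₀.embedding →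
          ∃ (ΩK : ℂ) (Ωp : ℂ_[p]) (Q : PowerSeries 𝓞_ℂ_[p]), ΩK ≠ 0 ∧ ‖Ωp‖ = 1 ∧
            R1.IsBDPLFunctionInt p ι' (primeOfEmbeddingDatum p ι' w₀.embedding) κ γ Dt.f ΩK Ωp Q ∧
            (XAc.charIdeal (W.baseChange K) p κ 𝔭bar ∅ γ).map (PowerSeries.map (R1.toCpInt p)) ≤
              Ideal.span {Q}

variable (d : ℤ)

/-- **(2.4)♭ ONE-SIDED CORE AT THE ERRATUM DATA OF ONE DISCRIMINANT `d` — RE-ORIENTED**: the body of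
`P2.IMCDivIntCoreFrameAtErratumDataB W p` VERBATIM with the extra binder `NumberField.discr K = d` (after
`IsErratumField W K q`), exactly as imc-p1's `P2.IMCDivIntCoreFrameAtDiscr` slices the A-shape. The statement of the
repaired crux's per-discriminant rungs. A predicate on `(W, p, d)`; nothing asserted.
[claim: Castella2018Erratum, status: under-review]
[cite: Castella2018, Thm. 3.1 and display (3.2) (arXiv:1704.06608 p. 9) (shape only; nothing asserted)] -/
@[conjecture]
def P2.IMCDivIntCoreFrameAtDiscrB : Prop :=
  ∀ [NeZero (W.conductorNorm ℤ)] (q : ℕ) [Fact q.Prime] (K : Type) [Field K] [NumberField K]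
    (Dt : ModularParametrizationData W (W.conductorNorm ℤ))
    (H : HeegnerDatum (W.conductorNorm ℤ) (NumberField.discr K)) (w₀ : InfinitePlace K)
    (P : (W.baseChange K).toAffine.Point), ErratumHypotheses W p → W.analyticRank = 1 →
    q ≠ p → Mult W q → ¬ W.HasSplitMultiplicativeReductionAtPrime q →
    ¬ p ∣ padicValInt q W.minimalDiscriminantInt → IsErratumField W K q → NumberField.discr K = d →
    Cas20Standing K p (W.conductorNorm ℤ / p) →
    WeierstrassCurve.Affine.Point.map w₀.embedding.toRatAlgHom P = heegnerPointComplex Dt H →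
    ¬ (p : ℤ) ∣ Dt.c → ¬ IsOfFinAddOrder P →
    ∀ (κ : ZpExtension K p), κ.IsAnticyclotomic →
      ∀ (γ : Field.absoluteGaloisGroup K) [Fact (κ.IsTopGenerator γ)] (ι' : PadicAlgCl p ≃+* ℂ)
        (e : K →+* ℚ_[p]),
        (∀ k : 𝓞 K, k ∈ (primeOfEmbeddingDatum p ι' w₀.embedding).asIdeal ↔ ‖e (k : K)‖ < 1) →
        ∀ (𝔭bar : HeightOneSpectrum (𝓞 K)), ((p : ℕ) : 𝓞 K) ∈ 𝔭bar.asIdeal →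
          𝔭bar ≠ primeOfEmbeddingDatum p ι' w₀.embedding →
          ∃ (ΩK : ℂ) (Ωp : ℂ_[p]) (Q : PowerSeries 𝓞_ℂ_[p]), ΩK ≠ 0 ∧ ‖Ωp‖ = 1 ∧
            R1.IsBDPLFunctionInt p ι' (primeOfEmbeddingDatum p ι' w₀.embedding) κ γ Dt.f ΩK Ωp Q ∧
            (XAc.charIdeal (W.baseChange K) p κ 𝔭bar ∅ γ).map (PowerSeries.map (R1.toCpInt p)) ≤
              Ideal.span {Q}

end Shape

/-! ### §2 Bridges (X-slot-free, hence verbatim from the A-versions) -/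

section Bridges

variable {W : WeierstrassCurve ℚ} [W.IsElliptic] [W.IsGloballyMinimal] {p : ℕ} [Fact p.Prime]

/-- Forget the value conjunct. [claim: Castella2018Erratum, status: under-review] -/
theorem P2.imcDivIntCoreFrameAtErratumDataB_of_imcDivIntFrameB (h : P2.IMCDivIntFrameAtErratumDataB W p) :
    P2.IMCDivIntCoreFrameAtErratumDataB W p := by
  intro _ q _ K _ _ Dt H w₀ P hE hr hqp hmq hns hvq hK hCas hP hc hinf κ hκ γ _ ι' e he 𝔭bar h𝔭bar hne
  obtain ⟨ΩK, Ωp, Q, hΩ, hΩp, hQ, -, h3At⟩ :=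
    h q K Dt H w₀ P hE hr hqp hmq hns hvq hK hCas hP hc hinf κ hκ γ ι' e he 𝔭bar h𝔭bar hne
  exact ⟨ΩK, Ωp, Q, hΩ, hΩp, hQ, h3At⟩

/-- On a SEMISTABLE pair the value conjunct comes from print (Cas18 Thms. 3.1–3.2, `h32`) at ANY ♭-frame at
`(ι′, 𝔭_{ι′})` (♭-V1RIG across periods, `R1.bdpValueAtOneIntAt_of_isBDPLFunctionInt`): core B-shape ⟹ B-shape with
value. The X-slot of the divisibility is not touched — proof verbatim from `P2.imcDivIntFrameAtErratumData_of_thm32_of_core`.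
[cite: Castella2018, Thm. 3.1, display (3.2) and Thm. 3.2 (arXiv:1704.06608 p. 9)] -/
theorem P2.imcDivIntFrameAtErratumDataB_of_thm32_of_coreB
    (h32 : thm32_exists_isBDPLFunction_valueAtOne) (hss : Semistable W)
    (h : P2.IMCDivIntCoreFrameAtErratumDataB W p) : P2.IMCDivIntFrameAtErratumDataB W p := by
  intro _ q _ K _ _ Dt H w₀ P hE hr hqp hmq hns hvq hK hCas hP hc hinf κ hκ γ _ ι' e he 𝔭bar h𝔭bar hne
  obtain ⟨ΩK, Ωp, Q, hΩ, hΩp, hQ, h3At⟩ :=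
    h q K Dt H w₀ P hE hr hqp hmq hns hvq hK hCas hP hc hinf κ hκ γ ι' e he 𝔭bar h𝔭bar hne
  obtain ⟨ΩK', Ωp', L', hΩ', hL', h2'⟩ :=
    R1.exists_frame_bdpValueAtOneOnTreeAt_of_thm32 h32 ι' Dt H hE hss hqp hK hc w₀ hP κ hκ γ he
  have hp2 : p ≠ 2 := hE.two_ne
  have hΩp0 : Ωp ≠ 0 := by
    intro h0
    rw [h0, norm_zero] at hΩp
    exact zero_ne_one hΩp
  have hΩp'0 : ((Ωp' : unrIntegers p) : ℂ_[p]) ≠ 0 := by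
    rw [Ne, ZeroMemClass.coe_eq_zero]
    exact Units.ne_zero Ωp'
  exact ⟨ΩK, Ωp, Q, hΩ, hΩp, hQ,
    R1.bdpValueAtOneIntAt_of_isBDPLFunctionInt hp2 hK.1 hκ hΩ hΩ' hΩp0 hΩp'0 hQ
      (R1.isBDPLFunctionInt_map hL') (R1.bdpValueAtOneIntAt_map h2'), h3At⟩

omit [W.IsElliptic] in
/-- The core B-shape gives its slice at every discriminant. [folklore] -/
theorem P2.imcDivIntCoreFrameAtDiscrB_of_atErratumDataB (h : P2.IMCDivIntCoreFrameAtErratumDataB W p) (d : ℤ) :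
    P2.IMCDivIntCoreFrameAtDiscrB W p d := by
  intro _ q _ K _ _ Dt H w₀ P hE hr hqp hmq hns hvq hK _hd hCas hP hc hinf κ hκ γ _ ι' e he 𝔭bar h𝔭bar hne
  exact h q K Dt H w₀ P hE hr hqp hmq hns hvq hK hCas hP hc hinf κ hκ γ ι' e he 𝔭bar h𝔭bar hne

omit [W.IsElliptic] in
/-- The slices at all discriminants give the core B-shape (`d := discr K`). [folklore] -/
theorem P2.imcDivIntCoreFrameAtErratumDataB_of_forall_atDiscrB
    (h : ∀ d : ℤ, P2.IMCDivIntCoreFrameAtDiscrB W p d) : P2.IMCDivIntCoreFrameAtErratumDataB W p := by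
  intro _ q _ K _ _ Dt H w₀ P hE hr hqp hmq hns hvq hK hCas hP hc hinf κ hκ γ _ ι' e he 𝔭bar h𝔭bar hne
  exact h (NumberField.discr K) q K Dt H w₀ P hE hr hqp hmq hns hvq hK rfl hCas hP hc hinf κ hκ γ ι' e he
    𝔭bar h𝔭bar hne

omit [W.IsElliptic] in
/-- **The repaired crux's core shape at a pair ⟺ its per-discriminant slices at every `d`.** [folklore] -/
theorem P2.imcDivIntCoreFrameAtErratumDataB_iff_forall_atDiscrB :
    P2.IMCDivIntCoreFrameAtErratumDataB W p ↔ ∀ d : ℤ, P2.IMCDivIntCoreFrameAtDiscrB W p d :=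
  ⟨P2.imcDivIntCoreFrameAtDiscrB_of_atErratumDataB, P2.imcDivIntCoreFrameAtErratumDataB_of_forall_atDiscrB⟩

end Bridges

/-! ### §3 Unit data: the printed frame is a unit, so the divisibility holds for EVERY X-slot -/

section UnitDatum

variable {W : WeierstrassCurve ℚ} [W.IsElliptic] [W.IsGloballyMinimal] {p : ℕ} [Fact p.Prime]
  {K : Type} [Field K] [NumberField K]

/-- **H3♭ WITH VALUE AT A UNIT DATUM, FOR EVERY X-SLOT, from print alone.** On a SEMISTABLE pair, at an erratum datum
with `‖(1 − a_p p⁻¹)·log_ω P‖ = 1`, imc-p1's `P2.exists_unitFrame_of_thm32_of_unitValue` gives a frame at `(ι′, 𝔭_{ι′})`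
with Castella's interpolation property, the value conjunct and `IsUnit Q`; hence `(Q) = ⊤` and the divisibility
`Ch_Λ(XAc … 𝔮 S γ)·𝓞_{ℂ_p}⟦T⟧ ⊆ (Q)` holds for EVERY prime `𝔮` and EVERY local-condition set `S` — in particular for the
A-slot `𝔭_{ι′}` and for the B-slot `𝔭bar`: unit rungs are `ι`-blind. CONDITIONAL on `h32` (PUBLISHED) and the unit
hypothesis; nothing booked. [cite: Castella2018, Thm. 3.1, display (3.2) and Thm. 3.2 (arXiv:1704.06608 p. 9)] -/
theorem P2.exists_unitFrame_forall_slot_of_thm32_of_unitValue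
    (h32 : thm32_exists_isBDPLFunction_valueAtOne)
    [NeZero (W.conductorNorm ℤ)] {q : ℕ} [Fact q.Prime]
    (Dt : ModularParametrizationData W (W.conductorNorm ℤ))
    (H : HeegnerDatum (W.conductorNorm ℤ) (NumberField.discr K)) (w₀ : InfinitePlace K)
    {P : (W.baseChange K).toAffine.Point} (hE : ErratumHypotheses W p) (hss : Semistable W)
    (hqp : q ≠ p) (hK : IsErratumField W K q)
    (hP : WeierstrassCurve.Affine.Point.map w₀.embedding.toRatAlgHom P = heegnerPointComplex Dt H)
    (hc : ¬ (p : ℤ) ∣ Dt.c)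
    (κ : ZpExtension K p) (hκ : κ.IsAnticyclotomic) (γ : Field.absoluteGaloisGroup K)
    [Fact (κ.IsTopGenerator γ)] (ι' : PadicAlgCl p ≃+* ℂ) {e : K →+* ℚ_[p]}
    (he : ∀ k : 𝓞 K, k ∈ (primeOfEmbeddingDatum p ι' w₀.embedding).asIdeal ↔ ‖e (k : K)‖ < 1)
    (hunit : ‖((1 : ℚ_[p]) - (W.LFunction p : ℚ_[p]) * (p : ℚ_[p])⁻¹) * logOmega W p e P‖ = 1) :
    ∃ (ΩK : ℂ) (Ωp : ℂ_[p]) (Q : PowerSeries 𝓞_ℂ_[p]), ΩK ≠ 0 ∧ ‖Ωp‖ = 1 ∧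
      R1.IsBDPLFunctionInt p ι' (primeOfEmbeddingDatum p ι' w₀.embedding) κ γ Dt.f ΩK Ωp Q ∧
      R1.BDPValueAtOneIntAt W p e P Q (W.LFunction p) ∧
      ∀ (𝔮 : HeightOneSpectrum (𝓞 K)) (S : Set (HeightOneSpectrum (𝓞 K))),
        (XAc.charIdeal (W.baseChange K) p κ 𝔮 S γ).map (PowerSeries.map (R1.toCpInt p)) ≤ Ideal.span {Q} := by
  obtain ⟨ΩK, Ωp, Q, hΩ, hΩp, hQ, hval, hQu⟩ :=
    P2.exists_unitFrame_of_thm32_of_unitValue h32 Dt H w₀ hE hss hqp hK hP hc κ hκ γ ι' he hunit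
  exact ⟨ΩK, Ωp, Q, hΩ, hΩp, hQ, hval, fun 𝔮 S ↦ by rw [Ideal.span_singleton_eq_top.mpr hQu]; exact le_top⟩

variable {d : ℤ}

/-- **The B-slice at discriminant `d` from Castella 2018 Thms. 3.1–3.2 + the unit-value certificate at `d`**, on a
SEMISTABLE pair (the re-oriented twin of imc-p1's `P2.imcDivIntFrameAtDiscr_of_thm32_of_unitCertAtDiscr`, through the
slot-free unit lemma above): the hypotheses of the landed unit rungs VERBATIM, so each re-reads for the B-atom in one line.
CONDITIONAL on `h32` (PUBLISHED) and the ATTESTED certificate; nothing booked; one slice only.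
[cite: Castella2018, Thm. 3.1, display (3.2) and Thm. 3.2 (arXiv:1704.06608 p. 9)] [cite: Castella2018Erratum, (2.4) (p. 4)] -/
theorem P2.imcDivIntCoreFrameAtDiscrB_of_thm32_of_unitCertAtDiscr
    (h32 : thm32_exists_isBDPLFunction_valueAtOne) (hss : Semistable W)
    (hunit : ∀ [NeZero (W.conductorNorm ℤ)] (q : ℕ) [Fact q.Prime] (K : Type) [Field K] [NumberField K]
      (Dt : ModularParametrizationData W (W.conductorNorm ℤ))
      (H : HeegnerDatum (W.conductorNorm ℤ) (NumberField.discr K)) (w₀ : InfinitePlace K)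
      (P : (W.baseChange K).toAffine.Point), ErratumHypotheses W p → W.analyticRank = 1 →
      q ≠ p → Mult W q → ¬ W.HasSplitMultiplicativeReductionAtPrime q →
      ¬ p ∣ padicValInt q W.minimalDiscriminantInt → IsErratumField W K q → NumberField.discr K = d →
      Cas20Standing K p (W.conductorNorm ℤ / p) →
      WeierstrassCurve.Affine.Point.map w₀.embedding.toRatAlgHom P = heegnerPointComplex Dt H →
      ¬ (p : ℤ) ∣ Dt.c → ¬ IsOfFinAddOrder P →
      ∀ (κ : ZpExtension K p), κ.IsAnticyclotomic →
        ∀ (γ : Field.absoluteGaloisGroup K) [Fact (κ.IsTopGenerator γ)] (ι' : PadicAlgCl p ≃+* ℂ)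
          (e : K →+* ℚ_[p]),
          (∀ k : 𝓞 K, k ∈ (primeOfEmbeddingDatum p ι' w₀.embedding).asIdeal ↔ ‖e (k : K)‖ < 1) →
          ‖((1 : ℚ_[p]) - (W.LFunction p : ℚ_[p]) * (p : ℚ_[p])⁻¹) * logOmega W p e P‖ = 1) :
    P2.IMCDivIntCoreFrameAtDiscrB W p d := by
  intro _ q _ K _ _ Dt H w₀ P hE hr hqp hmq hns hvq hK hd hCas hP hc hinf κ hκ γ _ ι' e he 𝔭bar _ _
  obtain ⟨ΩK, Ωp, Q, hΩ, hΩp, hQ, -, hall⟩ :=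
    P2.exists_unitFrame_forall_slot_of_thm32_of_unitValue h32 Dt H w₀ hE hss hqp hK hP hc κ hκ γ ι' he
      (hunit q K Dt H w₀ P hE hr hqp hmq hns hvq hK hd hCas hP hc hinf κ hκ γ ι' e he)
  exact ⟨ΩK, Ωp, Q, hΩ, hΩp, hQ, hall 𝔭bar ∅⟩

/-- **If EVERY erratum datum of a semistable pair is a unit datum, the B-shape with value holds at the pair from print**
(re-oriented twin of imc-p1's `P2.imcDivIntFrameAtErratumData_of_thm32_of_forall_unitValue`). CONDITIONAL on `h32`
and the unit hypothesis at every datum; nothing booked. [cite: Castella2018, Thms. 3.1–3.2 (arXiv:1704.06608 p. 9)] -/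
theorem P2.imcDivIntFrameAtErratumDataB_of_thm32_of_forall_unitValue
    (h32 : thm32_exists_isBDPLFunction_valueAtOne) (hss : Semistable W)
    (hunit : ∀ [NeZero (W.conductorNorm ℤ)] (q : ℕ) [Fact q.Prime] (K : Type) [Field K] [NumberField K]
      (Dt : ModularParametrizationData W (W.conductorNorm ℤ))
      (H : HeegnerDatum (W.conductorNorm ℤ) (NumberField.discr K)) (w₀ : InfinitePlace K)
      (P : (W.baseChange K).toAffine.Point), ErratumHypotheses W p → W.analyticRank = 1 →
      q ≠ p → Mult W q → ¬ W.HasSplitMultiplicativeReductionAtPrime q →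
      ¬ p ∣ padicValInt q W.minimalDiscriminantInt → IsErratumField W K q →
      Cas20Standing K p (W.conductorNorm ℤ / p) →
      WeierstrassCurve.Affine.Point.map w₀.embedding.toRatAlgHom P = heegnerPointComplex Dt H →
      ¬ (p : ℤ) ∣ Dt.c → ¬ IsOfFinAddOrder P →
      ∀ (κ : ZpExtension K p), κ.IsAnticyclotomic →
        ∀ (γ : Field.absoluteGaloisGroup K) [Fact (κ.IsTopGenerator γ)] (ι' : PadicAlgCl p ≃+* ℂ)
          (e : K →+* ℚ_[p]),
          (∀ k : 𝓞 K, k ∈ (primeOfEmbeddingDatum p ι' w₀.embedding).asIdeal ↔ ‖e (k : K)‖ < 1) →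
          ‖((1 : ℚ_[p]) - (W.LFunction p : ℚ_[p]) * (p : ℚ_[p])⁻¹) * logOmega W p e P‖ = 1) :
    P2.IMCDivIntFrameAtErratumDataB W p := by
  intro _ q _ K _ _ Dt H w₀ P hE hr hqp hmq hns hvq hK hCas hP hc hinf κ hκ γ _ ι' e he 𝔭bar _ _
  obtain ⟨ΩK, Ωp, Q, hΩ, hΩp, hQ, hval, hall⟩ :=
    P2.exists_unitFrame_forall_slot_of_thm32_of_unitValue h32 Dt H w₀ hE hss hqp hK hP hc κ hκ γ ι' he
      (hunit q K Dt H w₀ P hE hr hqp hmq hns hvq hK hCas hP hc hinf κ hκ γ ι' e he)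
  exact ⟨ΩK, Ωp, Q, hΩ, hΩp, hQ, hval, hall 𝔭bar ∅⟩

end UnitDatum

end Summit.BirchSwinnertonDyer.Rank1Residual.X11b

end
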